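import Mathlib

/-!
# Hodge-locus census — the divisibility step of PROPOSITION X41-STRATA (ENGINE B, gen 32, record §13d)

certified instances and evidence bearing on the general Hodge conjecture; no claim.

In the cells `(4,d,1)` (two coordinate planes meeting in a line, `k′ = 2`) the jump strata are
governed by a pair of coprime binary forms `h₁, h₂` of degree `d-1` and a form `g` of degree `d-2`.
The one non-formal step in the proof that `b = 2 ⟺ g divides a pencil member` is the elimination
"`g ∣ D·h₁`, `g ∣ D·h₂`, `h₁, h₂` without common factor ⇒ `g ∣ D`", after which a degree count
(`deg g = d-2 > 2 = deg D` for `d ≥ 5`) forces `D = 0`.  We record that step in its natural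
generality (any GCD monoid, e.g. a polynomial ring over a field), together with the
explicit incidence identity of the model member `h_i = x_i^{d-1}`, `g = x₁^{d-2} + x₂^{d-2}`,
whose kernel quadric `x₁x₂` satisfies `g·x₁x₂ = x₂·h₁ + x₁·h₂` with the two NON-proportional
linear coefficients `x₂, x₁` — the witness that the model member lies on the main component of the
stratum `{b ≥ 1}`.
-/

namespace Summit.HodgeConjecture.HodgeConjecture.HodgeLocus.Census.X41

/-- If `g` divides `D * h₁` and `D * h₂` and `h₁, h₂` have no common non-unit divisor, then `g ∣ D`. -/
theorem dvd_of_dvd_mul_pair {α : Type*} [CommMonoidWithZero α] [GCDMonoid α]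
    {g D h₁ h₂ : α} (hrel : IsRelPrime h₁ h₂) (hd₁ : g ∣ D * h₁) (hd₂ : g ∣ D * h₂) : g ∣ D := by
  have h1 : g ∣ gcd (D * h₁) (D * h₂) := dvd_gcd hd₁ hd₂
  have h2 : g ∣ D * gcd h₁ h₂ := (gcd_mul_left' D h₁ h₂).dvd_iff_dvd_right.mp h1
  have hu : IsUnit (gcd h₁ h₂) := hrel (gcd_dvd_left h₁ h₂) (gcd_dvd_right h₁ h₂)
  obtain ⟨u, hu'⟩ := hu
  rw [← hu'] at h2
  exact Units.dvd_mul_right.mp h2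

/-- The model member of `(4,d,1)`: with `h₁ = x₁^(e+1)`, `h₂ = x₂^(e+1)`, `g = x₁^e + x₂^e`
(`e = d-2`), the quadric `x₁ * x₂` is a kernel quadric: `g * (x₁ * x₂) = x₂ * h₁ + x₁ * h₂`. -/
theorem model_incidence {R : Type*} [CommRing R] (x₁ x₂ : R) (e : ℕ) :
    (x₁ ^ e + x₂ ^ e) * (x₁ * x₂) = x₂ * x₁ ^ (e + 1) + x₁ * x₂ ^ (e + 1) := by
  ring

end Summit.HodgeConjecture.HodgeConjecture.HodgeLocus.Census.X41
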